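import Literature.NumberTheory.Automorphic.ReciprocityGLn
import Literature.NumberTheory.Automorphic.AutomorphicRepsGLSatakeFlathProofs
import Literature.NumberTheory.Automorphic.SatakeParamNeZeroProofs
import Literature.NumberTheory.Automorphic.ChebotarevArtinRepHolds
import Literature.NumberTheory.GaloisRepresentations.LAdicRepFrobenius
import Literature.NumberTheory.GaloisRepresentations.WeakAbelianDirectSummandCyclotomicProofs
import Literature.NumberTheory.GaloisRepresentations.FramedRepTwist
import Literature.RepresentationTheory.Semisimple.Twist
import Literature.RepresentationTheory.Semisimple.SubrepresentationEquiv
import Literature.NumberTheory.GaloisRepresentations.IntegralGaloisActionProofs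
import Summits.Langlands.Langlands.Theorems.IrreducibilityBySelfDualityIrreducibleGL3CMCyclotomicUntwist
import HarnessLib

/-!
# `EssSelfDualIrreducibleCM` — Frobenius-level ingredients

Helper file for the item `EssSelfDualIrreducibleCM` (stmt-Langlands-13618) of the route
`IrreducibilityBySelfDuality`:
* `trace_identity_of_charpoly_eq` — at a good Frobenius, with `t_{π,v} = d · Ad{x, y}`,
  `charpoly r(Frob) = arithFrobPolyOfSatake ι q 3 t_{π,v}` and
  `charpoly ρ₁(Frob) = arithFrobPolyOfSatake ι q 2 {x, y}`:
  `tr r(Frob) · (q · ι⁻¹(d⁻¹)⁻¹) + 1 = tr ρ₁(Frob) · tr ρ₁(Frob)⁻¹` (the C-normalisations at `n = 3`,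
  `n = 2`, `n = 1` are consistent: both sides are `ι⁻¹(x/y + y/x + 2)`);
* `toRepresentation_twist`, `trace_twist` — the abstract representation / trace of a twist `r ⊗ χ`;
* `isOpen_ker_of_eigenmatrix`, `index_ker_eq_two` — the eigencharacter of an eigen-matrix of a
  continuous rank-2 representation cuts out an open subgroup of index `2`;
* `map_neg_eq_of_charpoly_neg_eq` — `charpoly(-ρ₁(Frob)) = charpoly(ρ₁(Frob))` forces the Satake
  parameter `{x, y}` to be stable under `b ↦ -b`.
-/

noncomputable section

set_option linter.dupNamespace false -- project-wide option (lakefile weak.linter.dupNamespace); `Summit.Langlands.Langlands` is the mandated namespace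

open scoped NumberField
open Matrix Polynomial Filter IsDedekindDomain Field
open Literature.NumberTheory.Automorphic Literature.NumberTheory.GaloisRepresentations

namespace Summit.Langlands.Langlands.Theorems.EssSelfDualIrreducibleCM

/-! ### Traces and determinants from characteristic polynomials -/

/-- If `M.charpoly = ∏_{t ∈ T} (X - t)` then `tr M = ∑ T`. [folklore] -/
theorem trace_eq_sum_of_charpoly_eq {R : Type*} [CommRing R] {n : Type*} [Fintype n] [DecidableEq n]
    {M : Matrix n n R} {T : Multiset R} (h : M.charpoly = (T.map fun t => X - C t).prod) :
    M.trace = T.sum := by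
  rw [Matrix.trace_eq_neg_charpoly_nextCoeff, h, Polynomial.multiset_prod_X_sub_C_nextCoeff, neg_neg]

/-- If `M.charpoly = (X - a)(X - b)` for a `2 × 2` matrix then `det M = ab`. [folklore] -/
theorem det_eq_mul_of_charpoly_eq {R : Type*} [CommRing R] {M : Matrix (Fin 2) (Fin 2) R} {a b : R}
    (h : M.charpoly = (({a, b} : Multiset R).map fun t => X - C t).prod) : M.det = a * b := by
  rw [Matrix.det_eq_sign_charpoly_coeff, h, Fintype.card_fin]
  simp

/-- `tr (M⁻¹) = (det M)⁻¹ · tr M` for `M ∈ GL₂` over a field (adjugate formula). [folklore] -/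
theorem trace_inv_fin_two {k : Type*} [Field k] (M : GL (Fin 2) k) :
    (((M⁻¹ : GL (Fin 2) k)) : Matrix (Fin 2) (Fin 2) k).trace =
      ((M : Matrix (Fin 2) (Fin 2) k).det)⁻¹ * (M : Matrix (Fin 2) (Fin 2) k).trace := by
  rw [Matrix.coe_units_inv, Matrix.inv_def, Ring.inverse_eq_inv, Matrix.trace_smul, Matrix.adjugate_fin_two,
    smul_eq_mul, Matrix.trace_fin_two, Matrix.trace_fin_two]
  simp only [Matrix.of_apply, Matrix.cons_val', Matrix.cons_val_zero, Matrix.cons_val_fin_one,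
    Matrix.cons_val_one]
  ring

/-! ### The adjoint Satake parameter `d · Ad{x, y} = {d x/y, d y/x, d}` -/

/-- `d · ((β × β).map (p ↦ p₁ p₂⁻¹) ∖ {1}) = {d x/y, d y/x, d}` for `β = {x, y}` with `x, y ≠ 0`
(the Satake parameter of `ν ⊗ Ad(σ)` at a place where `σ` has parameter `{x, y}`). [folklore] -/
theorem adParams_pair {x y : ℂ} (hx : x ≠ 0) (hy : y ≠ 0) (d : ℂ) :
    ((((({x, y} : Multiset ℂ) ×ˢ ({x, y} : Multiset ℂ)).map fun p : ℂ × ℂ => p.1 * p.2⁻¹).erase 1).map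
        fun c => d * c) = {d * (x * y⁻¹), d * (y * x⁻¹), d} := by
  simp only [Multiset.insert_eq_cons, Multiset.product_cons, Multiset.map_cons, Multiset.map_singleton,
    Multiset.cons_product, Multiset.product_singleton, Multiset.singleton_add, Multiset.add_cons, Multiset.cons_add,
    mul_inv_cancel₀ hx, mul_inv_cancel₀ hy]
  rw [Multiset.cons_swap (x * y⁻¹) (1 : ℂ), Multiset.erase_cons_head]
  simp

/-! ### The trace identity at a Frobenius element -/

/-- `arithFrobPolyOfSatake ι q m α = ∏_{t ∈ T} (X - t)` with `T = {ι⁻¹((√q^{m-1} a)⁻¹) : a ∈ α}`. [folklore] -/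
theorem arithFrobPolyOfSatake_eq_prod {ℓ : ℕ} [Fact ℓ.Prime] (ι : PadicAlgCl ℓ ≃+* ℂ) (q m : ℕ)
    (α : Multiset ℂ) :
    arithFrobPolyOfSatake ι q m α =
      ((α.map fun a => ι.symm (((Real.sqrt q : ℝ) : ℂ) ^ (m - 1) * a)⁻¹).map fun t => X - C t).prod := by
  rw [arithFrobPolyOfSatake, Multiset.map_map]
  rfl

/-- **The trace identity at a good Frobenius.**  Let `ι : ℚ̄_ℓ ≃ ℂ`, `q ≠ 0`, `x, y, d ∈ ℂˣ`.  If a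
`3 × 3` matrix `M₃` has characteristic polynomial `arithFrobPolyOfSatake ι q 3 {d x/y, d y/x, d}`
(roots `ι⁻¹((q d x/y)⁻¹), ι⁻¹((q d y/x)⁻¹), ι⁻¹((q d)⁻¹)`) and `M₂ ∈ GL₂` has characteristic polynomial
`arithFrobPolyOfSatake ι q 2 {x, y}` (roots `ι⁻¹((√q x)⁻¹), ι⁻¹((√q y)⁻¹)`), then
`tr M₃ · (q · ι⁻¹(d⁻¹)⁻¹) + 1 = tr M₂ · tr M₂⁻¹` — both sides equal `ι⁻¹(x/y + y/x + 2)`.  This is the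
Frobenius-level form of `χ_{r ⊗ ψ⁻¹ ⊗ χ_cyc} + 1 = χ_{ρ_σ} χ_{ρ_σ^∨}` for `t_π = d · Ad(t_σ)`.
[folklore] -/
theorem trace_identity_of_charpoly_eq {ℓ : ℕ} [Fact ℓ.Prime] (ι : PadicAlgCl ℓ ≃+* ℂ) {q : ℕ}
    (hq : q ≠ 0) {x y d : ℂ} (hx : x ≠ 0) (hy : y ≠ 0) (hd : d ≠ 0)
    {M₃ : Matrix (Fin 3) (Fin 3) (PadicAlgCl ℓ)} {M₂ : GL (Fin 2) (PadicAlgCl ℓ)}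
    (h₃ : M₃.charpoly = arithFrobPolyOfSatake ι q 3 {d * (x * y⁻¹), d * (y * x⁻¹), d})
    (h₂ : (M₂ : Matrix (Fin 2) (Fin 2) (PadicAlgCl ℓ)).charpoly = arithFrobPolyOfSatake ι q 2 {x, y}) :
    M₃.trace * ((q : PadicAlgCl ℓ) * (ι.symm d⁻¹)⁻¹) + 1 =
      (M₂ : Matrix (Fin 2) (Fin 2) (PadicAlgCl ℓ)).trace *
        ((M₂⁻¹ : GL (Fin 2) (PadicAlgCl ℓ)) : Matrix (Fin 2) (Fin 2) (PadicAlgCl ℓ)).trace := by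
  rw [arithFrobPolyOfSatake_eq_prod] at h₃ h₂
  set s : ℂ := ((Real.sqrt q : ℝ) : ℂ) with hs
  have hs0 : s ≠ 0 := by
    rw [hs, Complex.ofReal_ne_zero]
    exact Real.sqrt_ne_zero'.mpr (by exact_mod_cast Nat.pos_of_ne_zero hq)
  have hs2 : s ^ 2 = (q : ℂ) := by
    rw [hs, ← Complex.ofReal_pow, Real.sq_sqrt (Nat.cast_nonneg q), Complex.ofReal_natCast]
  have htr₃ := trace_eq_sum_of_charpoly_eq h₃
  have htr₂ := trace_eq_sum_of_charpoly_eq h₂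
  have hdet₂ : (M₂ : Matrix (Fin 2) (Fin 2) (PadicAlgCl ℓ)).det =
      ι.symm (s ^ (2 - 1) * x)⁻¹ * ι.symm (s ^ (2 - 1) * y)⁻¹ :=
    det_eq_mul_of_charpoly_eq (by rw [h₂]; simp)
  rw [trace_inv_fin_two, hdet₂, htr₃, htr₂]
  simp only [Multiset.insert_eq_cons, Multiset.map_cons, Multiset.map_singleton, Multiset.sum_cons,
    Multiset.sum_singleton]
  apply ι.injective
  simp only [map_add, map_mul, map_inv₀, map_one, map_natCast, RingEquiv.apply_symm_apply]
  rw [← hs2]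
  simp only [show (3 - 1 : ℕ) = 2 from rfl, show (2 - 1 : ℕ) = 1 from rfl, pow_one]
  field_simp
  ring

/-! ### Twists of framed representations and the underlying abstract representation -/

section Twist

variable {G : Type*} {A : Type*} [Group G] [TopologicalSpace G] [Field A] [TopologicalSpace A]
  [IsTopologicalRing A] {n : ℕ}

/-- The representation on `Aⁿ` underlying the twist `ρ ⊗ χ` is the twist of the representation
underlying `ρ` (same vectors, `g ↦ χ(g) ρ(g)`). [folklore] -/
theorem toRepresentation_twist (ρ : FramedRep G A n) (χ : G →ₜ* Aˣ) :
    FramedRep.toRepresentation (ρ.twist χ) =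
      Literature.RepresentationTheory.Semisimple.Representation.twist (FramedRep.toRepresentation ρ)
        χ.toMonoidHom := by
  refine MonoidHom.ext fun g => LinearMap.ext fun v => ?_
  rw [FramedRep.toRepresentation_apply_apply, FramedRep.coe_twist_apply, Matrix.smul_mulVec,
    Literature.RepresentationTheory.Semisimple.Representation.twist_apply_apply,
    FramedRep.toRepresentation_apply_apply]
  rfl

/-- The trace of a twist: `tr (ρ ⊗ χ)(g) = χ(g) tr ρ(g)`. [folklore] -/
theorem trace_twist (ρ : FramedRep G A n) (χ : G →ₜ* Aˣ) (g : G) :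
    FramedRep.trace (ρ.twist χ) g = (χ g : A) * FramedRep.trace ρ g := by
  unfold FramedRep.trace
  rw [FramedRep.coe_twist_apply, Matrix.trace_smul, smul_eq_mul]

end Twist

/-! ### The eigencharacter of an eigen-matrix of a CONTINUOUS representation has open kernel -/

section OpenKernel

variable {G : Type*} {A : Type*} [Group G] [TopologicalSpace G] [Field A] [TopologicalSpace A]
  [IsTopologicalRing A] [T1Space A]

/-- If `T ≠ 0` is an eigen-matrix of the conjugations by a continuous `ρ : G → GL₂(A)` with a
`{±1}`-valued eigencharacter `χ` (`2 ≠ 0` in `A`), then `ker χ` is open: `χ(g) = ±1` is read off a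
non-zero entry of the continuous `g ↦ ρ(g) T ρ(g)⁻¹`, and `{χ = -1}` is closed. [folklore] -/
theorem isOpen_ker_of_eigenmatrix (h2 : (2 : A) ≠ 0) (ρ : FramedRep G A 2) {T : Matrix (Fin 2) (Fin 2) A}
    (hT : T ≠ 0) (χ : G →* Aˣ)
    (h : ∀ g, (ρ g : Matrix (Fin 2) (Fin 2) A) * T * ((ρ g)⁻¹ : GL (Fin 2) A) = (χ g : A) • T)
    (hsq : ∀ g, (χ g : A) ^ 2 = 1) : IsOpen (χ.ker : Set G) := by
  -- a non-zero entry `T i j`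
  obtain ⟨i, j, hij⟩ : ∃ i j, T i j ≠ 0 := by
    by_contra hall
    push Not at hall
    exact hT (Matrix.ext fun i j => by rw [hall i j, Matrix.zero_apply])
  -- the continuous function `g ↦ (ρ(g) T ρ(g)⁻¹) i j = χ(g) T i j`
  set f : G → A := fun g => ((ρ g : Matrix (Fin 2) (Fin 2) A) * T * ((ρ g)⁻¹ : GL (Fin 2) A)) i j with hf
  have hfc : Continuous f := by
    have h1 : Continuous fun g => ((ρ g : GL (Fin 2) A) : Matrix (Fin 2) (Fin 2) A) :=
      Units.continuous_val.comp (map_continuous ρ)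
    have h2' : Continuous fun g => (((ρ g)⁻¹ : GL (Fin 2) A) : Matrix (Fin 2) (Fin 2) A) :=
      Units.continuous_coe_inv.comp (map_continuous ρ)
    exact ((h1.matrix_mul continuous_const).matrix_mul h2').matrix_elem i j
  have hfχ : ∀ g, f g = (χ g : A) * T i j := fun g => by
    rw [hf]
    change ((ρ g : Matrix (Fin 2) (Fin 2) A) * T * ((ρ g)⁻¹ : GL (Fin 2) A)) i j = _
    rw [h g, Matrix.smul_apply, smul_eq_mul]
  -- `ker χ` is the complement of the closed set `{f = -T i j}`
  have hχval : ∀ g, (χ g : A) = 1 ∨ (χ g : A) = -1 := fun g => by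
    have : ((χ g : A) - 1) * ((χ g : A) + 1) = 0 := by linear_combination hsq g
    rcases mul_eq_zero.mp this with h0 | h0
    · exact Or.inl (sub_eq_zero.mp h0)
    · exact Or.inr (eq_neg_of_add_eq_zero_left h0)
  have hne : (T i j) ≠ -T i j := fun h0 => by
    have : (2 : A) * T i j = 0 := by linear_combination h0
    exact hij ((mul_eq_zero.mp this).resolve_left h2)
  have hset : (χ.ker : Set G) = (f ⁻¹' {-T i j})ᶜ := by
    ext g
    simp only [SetLike.mem_coe, MonoidHom.mem_ker, Set.mem_compl_iff, Set.mem_preimage, Set.mem_singleton_iff,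
      hfχ]
    constructor
    · intro hg
      rw [hg, Units.val_one, one_mul]
      exact hne
    · intro hg
      rcases hχval g with h0 | h0
      · exact Units.val_eq_one.mp h0
      · exact absurd (by rw [h0, neg_one_mul]) hg
  rw [hset, isOpen_compl_iff]
  exact (isClosed_singleton.preimage hfc)

end OpenKernel

/-- A `{±1}`-valued character which is not trivial has kernel of index `2` (`-1 ≠ 1`). [folklore] -/
theorem index_ker_eq_two {G : Type*} [Group G] {A : Type*} [CommRing A] [NoZeroDivisors A] (h2 : (2 : A) ≠ 0)
    (χ : G →* Aˣ) (hsq : ∀ g, (χ g : A) ^ 2 = 1) {g₀ : G} (hg₀ : χ g₀ ≠ 1) : χ.ker.index = 2 := by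
  have hχval : ∀ g, (χ g : A) = 1 ∨ (χ g : A) = -1 := fun g => by
    have : ((χ g : A) - 1) * ((χ g : A) + 1) = 0 := by linear_combination hsq g
    rcases mul_eq_zero.mp this with h0 | h0
    · exact Or.inl (sub_eq_zero.mp h0)
    · exact Or.inr (eq_neg_of_add_eq_zero_left h0)
  have hm1 : (-1 : A) ≠ 1 := fun h0 => h2 (by linear_combination -h0)
  have hg₀' : (χ g₀ : A) = -1 :=
    (hχval g₀).resolve_left fun h0 => hg₀ (Units.val_eq_one.mp h0)
  rw [Subgroup.index_eq_two_iff]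
  refine ⟨g₀, fun b => ?_⟩
  simp only [MonoidHom.mem_ker, map_mul]
  rcases hχval b with hb | hb
  · have hb1 : χ b = 1 := Units.val_eq_one.mp hb
    refine Or.inr ⟨hb1, fun h0 => ?_⟩
    rw [hb1, one_mul] at h0
    exact hg₀ h0
  · have hb1 : χ b ≠ 1 := fun h0 => hm1 (by rw [← hb, h0, Units.val_one])
    refine Or.inl ⟨?_, hb1⟩
    apply Units.val_injective
    rw [Units.val_mul, hb, hg₀', Units.val_one]
    ring

/-! ### Satake parameters stable under `b ↦ -b` from `ρ ≅ ρ ⊗ χ` at a Frobenius with `χ = -1` -/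

/-- If `M ∈ M₂(ℚ̄_ℓ)` has characteristic polynomial `arithFrobPolyOfSatake ι q 2 β` (`q ≠ 0`) and
`-M` has the same characteristic polynomial, then the multiset `β` is stable under `b ↦ -b`
(the roots `ι⁻¹((√q b)⁻¹)` determine `b`). [folklore] -/
theorem map_neg_eq_of_charpoly_neg_eq {ℓ : ℕ} [Fact ℓ.Prime] (ι : PadicAlgCl ℓ ≃+* ℂ) {q : ℕ} (hq : q ≠ 0)
    {M : Matrix (Fin 2) (Fin 2) (PadicAlgCl ℓ)} {β : Multiset ℂ}
    (hM : M.charpoly = arithFrobPolyOfSatake ι q 2 β)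
    (hneg : ((((-1 : (PadicAlgCl ℓ)ˣ)) : PadicAlgCl ℓ) • M).charpoly = M.charpoly) :
    β.map (fun b => (-1 : ℂ) * b) = β := by
  rw [arithFrobPolyOfSatake_eq_prod] at hM
  set f : ℂ → PadicAlgCl ℓ := fun a => ι.symm (((Real.sqrt q : ℝ) : ℂ) ^ (2 - 1) * a)⁻¹ with hf
  have hs0 : ((Real.sqrt q : ℝ) : ℂ) ≠ 0 := by
    rw [Complex.ofReal_ne_zero]
    exact Real.sqrt_ne_zero'.mpr (by exact_mod_cast Nat.pos_of_ne_zero hq)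
  have hfinj : Function.Injective f := by
    intro a b hab
    have := ι.symm.injective hab
    rw [_root_.inv_inj] at this
    exact mul_left_cancel₀ (pow_ne_zero _ hs0) this
  have hfneg : ∀ b, f ((-1 : ℂ) * b) = ((-1 : (PadicAlgCl ℓ)ˣ) : PadicAlgCl ℓ) * f b := fun b => by
    simp only [hf, Units.val_neg, Units.val_one, neg_one_mul, mul_neg, inv_neg, map_neg]
  have h1 := Summit.Langlands.Langlands.Theorems.IrreducibleGL3CM.charpoly_units_smul_of_charpoly_eq_prod
    (-1 : (PadicAlgCl ℓ)ˣ) hM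
  rw [hneg, hM] at h1
  have e : (β.map f).map (fun r => X - C (((-1 : (PadicAlgCl ℓ)ˣ) : PadicAlgCl ℓ) * r)) =
      ((β.map f).map fun r => ((-1 : (PadicAlgCl ℓ)ˣ) : PadicAlgCl ℓ) * r).map (fun a => X - C a) := by
    simp only [Multiset.map_map, Function.comp_def]
  rw [e] at h1
  -- equal products of linear factors have equal root multisets
  have h2 := congrArg Polynomial.roots h1
  rw [Polynomial.roots_multiset_prod_X_sub_C, Polynomial.roots_multiset_prod_X_sub_C, Multiset.map_map] at h2
  apply Multiset.map_injective hfinj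
  rw [Multiset.map_map, h2]
  refine Multiset.map_congr rfl fun b _ => ?_
  simp only [Function.comp_apply, hfneg]


end Summit.Langlands.Langlands.Theorems.EssSelfDualIrreducibleCM

end
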